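import Literature.AlgebraicGeometry.HodgeTheory.WeilClassesBFSheafSeed
import Literature.AlgebraicGeometry.HodgeTheory.ISemiregularOfSchemeIso
import HarnessLib

/-!
# Buchweitz–Flenner sheaf seeds at tensor points: ONE model suffices (door II′ of the Weil ladder)

Layer `Literature/AlgebraicGeometry/HodgeTheory`. THEOREMS ONLY (no definition, no named fact; D-0026). The seed
predicate `HasTensorBFSheafSeeds C k p I` of `WeilClassesBFSheafSeed.lean` asks, at every tensor point `(Y, Ψ)`, every
Weil class `x`, every projective embedding with a class `a`, for an `I`-semiregular finite locally free `ℰ₀` with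
prescribed Chern character ON EVERY MODEL `e : Y ≅ X₀` («every model `e : Y ≅ X₀`» in its docstring — the quantifier
was needed because the tree could not transport `IsISemiregular` along `e`). With
`IsISemiregular.of_schemeIso` (`ISemiregularOfSchemeIso.lean`) the seed ON `Y` ITSELF suffices:

* `hasTensorBFSheafSeeds_of_oneModel` — the clause of `HasTensorBFSheafSeeds` with `X₀ := Y.X`, `e := Iso.refl`
  (stated inline) implies `HasTensorBFSheafSeeds C k p I`: push `ℰ₀` forward along each `e` (finite locally free,
  `I`-semiregular there, `e^* ch_q(e_*ℰ₀) = ch_q(ℰ₀)`).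

References: [BuchweitzFlenner2003] §5 (I-semiregular), Thm. 5.1 (hypotheses); [Fulton1998] §15.1 (ii).
-/

noncomputable section

open CategoryTheory AlgebraicGeometry
open AlgebraicGeometry.Scheme.Modules

namespace Literature.AlgebraicGeometry.HodgeTheory

open Literature.AlgebraicTopology.SingularHomology Literature.AlgebraicGeometry.Motives
open Literature.AlgebraicGeometry.Modules

/-- **One model suffices for the Buchweitz–Flenner tensor sheaf seeds**: if at every tensor point `(Y, Ψ)` (clause of
`HasTensorBFSheafSeeds` verbatim), for every non-zero rational Weil class `x` and every projective embedding with a non-zero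
rational `a`, there is an `I`-semiregular finite locally free `ℰ₀` ON `Y` with `ch_k(ℰ₀) = q·(ι^*a)ᵏ + x` and
`ch_{p'}(ℰ₀) = c_{p'}·(ι^*a)^{p'}` (`p' ∈ I`, `p' ≠ k`), then `HasTensorBFSheafSeeds C k p I` (the same on EVERY model
`e : Y ≅ X₀`): take `e_* ℰ₀` — finite locally free (`IsFiniteLocallyFree.pushforward_of_iso`), `I`-semiregular
(`IsISemiregular.of_schemeIso`: «`ℰ_0` is called `I`-semiregular if the part `σ_I` of the semiregularity map is injective»
is invariant under isomorphisms of the pair), with `e^* ch_q(e_*ℰ₀) = e^*(e⁻¹)^* ch_q(ℰ₀) = ch_q(ℰ₀)`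
(`ChernCharacterBetti.ch_pushforward_of_iso`). [cite: BuchweitzFlenner2003, §5 (I-semiregular)] [cite: Fulton1998, §15.1 (ii)] -/
theorem hasTensorBFSheafSeeds_of_oneModel (C : ChernCharacterBetti) (k p : ℕ) (I : Finset ℕ)
    (h : ∀ (Y : Motives.AbelianVariety ℂ) (Ψ : Y ⟶ Y), Y.dim = 2 * k → Ψ ≫ Ψ = -((p : ℤ) • 𝟙 Y) →
      (∃ (A₁ : Motives.AbelianVariety ℂ) (f₁ : Y ⟶ A₁.prod A₁) (g₁ : A₁.prod A₁ ⟶ Y) (m : ℕ),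
        A₁.dim = k ∧ 0 < m ∧ f₁ ≫ g₁ = m • 𝟙 Y ∧ AlgebraicGeometry.Flat f₁.hom.hom.hom.left ∧
        g₁ ≫ Ψ = Motives.AbelianVariety.prodLift
          (Motives.AbelianVariety.snd A₁ A₁ ≫ (-((p : ℤ) • 𝟙 A₁))) (Motives.AbelianVariety.fst A₁ A₁) ≫ g₁) →
      ∀ (x : complexBetti Y.X (2 * k)), x ∈ weilClassesOf Y Ψ k p → IsRationalClass x → x ≠ 0 →
      ∀ (emb : Motives.ProjectiveEmbedding Y.X) (a : complexBetti (Motives.projectiveSpace emb.n ℂ) 2),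
        IsRationalClass a → a ≠ 0 →
        ∃ (E₀ : Y.X.left.Modules) (hE₀ : Motives.IsFiniteLocallyFree E₀) (q : ℚ) (c : ℕ → ℚ),
          k ∈ I ∧ IsISemiregular hE₀ {q' | q' + 1 ∈ I} ∧
          C.ch Y.X E₀ k = ((q : ℚ) : ℂ) • cupPowTwo (complexBetti.map emb.ι 2 a) k + x ∧
          ∀ p' ∈ I, p' ≠ k → C.ch Y.X E₀ p' = ((c p' : ℚ) : ℂ) • cupPowTwo (complexBetti.map emb.ι 2 a) p') :
    HasTensorBFSheafSeeds C k p I := by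
  intro Y Ψ hY hΨ hpair x hx hxr hx0 emb a ha ha0 X₀ e
  obtain ⟨E₀, hE₀, q, c, hkI, hsr, hchk, hchp⟩ := h Y Ψ hY hΨ hpair x hx hxr hx0 emb a ha ha0
  refine ⟨(pushforward e.hom.left).obj E₀, hE₀.pushforward_of_iso (leftIso' e), q, c, hkI,
    IsISemiregular.of_schemeIso e hE₀ hsr, ?_, fun p' hp' hpk => ?_⟩
  · rw [ChernCharacterBetti.ch_pushforward_of_iso C e hE₀,
      BuchweitzFlenner2003_variationalHodge_ISemiregular_model.map_hom_map_inv, hchk]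
  · rw [ChernCharacterBetti.ch_pushforward_of_iso C e hE₀,
      BuchweitzFlenner2003_variationalHodge_ISemiregular_model.map_hom_map_inv, hchp p' hp' hpk]

end Literature.AlgebraicGeometry.HodgeTheory

end
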